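import Summits.QuantumFields.YangMills.Theorems.UnitScaleTiltProp7SectET3CurvedPropagatorsT3Rows
import Summits.QuantumFields.YangMills.Theorems.UnitScaleTiltProp7SectET3GaugeProjectorT3Rows
import HarnessLib

/-!
# Route `UnitScaleTilt`, crux «MinimiserStabilityRegPr» (stmt-QuantumFields-19200, stub EX) ∕ (O″χ) B0 (stmt-QuantumFields-20520), node N06(d = 3), route (α) —
# LAYER 0, ROWS (def-free), L0e PART 2: **THE IDENTITIES (3.124)₂ `QGDR = 0` AND `RD*GDR = R` FOR THE LAYER-0 LETTERS, HENCE «`Q𝔊 = 0`» AND THE EX BINDER `h102` VERBATIM**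
# ([Balaban1985BackgroundPropagators] (3.124) p.420, (3.147) «Q𝔓 = 0» p.425; [Balaban1985Variational] (102) p.293 «Q𝔊 = 0») — the `B6Eq231` mechanism run at the T³ member on brick L0c's
# intrinsic gauge projector (★★OWNER ACK 32 (q1): «(3.124) is the B6Eq231 mechanism from `Q∘D = 0` on `N_S` BY CONSTRUCTION — row of L0e»), for ANY Hessian letter `Δx` that kills the residual
# pure gauges (`Δx(U₀)(D_{U₀}λ) = 0`, `λ ∈ N_S(U₀)` — true for print's `Δ_π` (3.119) by its gauge invariance, brick L0b part 2's row), on the class `PosOnto`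

Cell `ym-inputs` (desk `pub/ym-inputs`, INPUT-LIST.md v6 §4 row p01; memo `pub/ym-inputs/DEFINER-MEMO-T3.md` §2 L0e).  THEOREMS ONLY (0 `def`, 0 `sorry`); `--supports stmt-QuantumFields-20520
--as helper`; count-neutral.  YM₃ on T³ is ladder rung R3, NOT the Clay problem; nothing here is a claim about a stub, a crux, d = 4 or the mass gap.

THE PRINT.  [Balaban1985BackgroundPropagators] p. 420: *«We will prove that the second term in the last line vanishes. More exactly we will prove the identities RD*GQ* = 0, hence QGDR = 0. (3.124)»*
(print's proof: Gaussian integration (3.125)); [Balaban1984PropagatorsII] (2.31) `R∂*G∂R = R`, (2.34) `R∂*GQ* = 0, QG∂R = 0` (the flat originals; tree: `B6Eq231`, algebraic); [Balaban1985Variational] p. 294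
*«the operator G₁𝔓* is equal to the operator 𝔊 … satisfying the equalities Q𝔊 = 0, RD*𝔊 = 0»*, (102) p. 293.

THE MECHANISM (as in `B6Eq231`, here at the member's letters).  For `f` in the gauge-parameter space, `R_S f = Δ^η λ₀` with `λ₀ ∈ N_S` (✓`exists_mem_NS_RS_eq`).  Then
`Δ_a(Dλ₀) = Δx(Dλ₀) + D R_S D*Dλ₀ + Q*aQ(Dλ₀) = 0 + D R_S Δ^ηλ₀ + 0 = D Δ^ηλ₀ = D R_S f` (`Δx` kills `D N_S`; `Q∘D = 0` on `N_S` ✓`QL2_DL2_eq_zero_of_mem_NS`; `R_S` fixes `Δ^ηN_S`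
✓`RS_apply_covLapSite_of_mem`), so `G(DR_Sf) = Dλ₀` on the class (`G = Δ_a⁻¹`), whence `QGDR_Sf = QDλ₀ = 0` ((3.124)₂) and `R_SD*GDR_Sf = R_SΔ^ηλ₀ = R_Sf`.  These are exactly the two data relations
`h124`, `hRDR` of lit-balaban's `B11Eq111FrakG.apply_Q_frakGLin`∕`apply_RDstar_frakGLin`; with `hK` (✓`Qk_GT_adjoint_KinvT`) the first gives «`Q𝔊 = 0`» for brick L0d's `frakGT`∕`frakGfR`.  The adjoint identity
(3.124)₁ `R_SD*GQ* = 0` (⇒ the Landau members `h102L`∕`h129L`∕(45)₂) needs in addition the SELF-ADJOINTNESS of `G` (⇐ of the Hessian letter) — a separate row.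

WHAT IS PROVED (member `F`, `h : n ≤ K`, parameters `c₀ cB a`, letter `Δx`; `hp : PosOnto … Δx U₀`, `hΔ : ∀ λ ∈ N_S(U₀), Δx U₀ (D_{U₀}λ) = 0`):
`GT_laplaceA` (`GΔ_a = 1` on the class), `laplaceA_apply` (unfolding `Δ_a = Δx + DR_SD* + Q*aQ`), `laplaceA_DL2_of_mem_NS` (`Δ_a(Dλ) = D(Δ^ηλ)` on `N_S`), ★`GT_DL2_RS` (`G(DR_Sf) = Dλ₀`),
★★`Qk_GT_DL2_RS` ((3.124)₂ `QGDR_S = 0`), ★★`RS_DstarL2_GT_DL2_RS` (`R_SD*GDR_S = R_S`), ★★`Qk_frakGT` («`Q𝔊 = 0`», Hilbert level), `iota_frakGfR_eq` (the EX reading of `𝒢f` IS `toL2⁻¹ ∘ 𝔊 ∘ …`),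
★★★`QTwS_iota_frakGfR` — **the EX binder `h102` VERBATIM for the layer-0 letter `𝒢f := frakGfR … Δx` (the reader of record, L0d v1.1) and the averaging of record `QTwS`**: `QTwS U₀ (fun b ↦ JetSup.equiv _ _ _ (frakGfR … U₀ f) (bondEquiv F K b)) = 0`.
HONEST SCOPE.  Finite-dimensional algebra on the classes; positivity NOT proved; `hΔ` is DISCHARGED for `Δx := DeltaPiSlot` in the sibling rows of `…SectET3DeltaPiT3` (not here); nothing of print asserted.

References: T. Bałaban, CMP **99** (1985) 389–434 [Balaban1985BackgroundPropagators] ((3.124) p.420, (3.147) p.425); CMP **96** (1984) 223–250 [Balaban1984PropagatorsII] ((2.31), (2.34) pp.227–228);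
CMP **102** (1985) 277–309 [Balaban1985Variational] ((102) p.293, (110)–(111) p.294).
-/

set_option autoImplicit false

noncomputable section

open scoped InnerProductSpace ComplexConjugate Matrix.Norms.L2Operator

namespace Summit.QuantumFields.YangMills.Theorems.Prop7SectET3CurvedPropagators

open Literature.MathematicalPhysics.QuantumFieldTheory.Balaban1983to89
open Literature.MathematicalPhysics.QuantumFieldTheory.Balaban1983to89.T3ContinuumYM3Torus
open T3SectALandauChart (eta)
open B9SectCLatticeCarrier (Bond)
open B9Eq311L2Pairing (WL2)
open B11Eq115Space (NegSize Space115 JetSup NegSup)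
open B11Eq111FrakG (apply_Q_frakGLin)
open B11Eq103H1Complex (SiteL2K BondL2K laplaceAK_apply G1K_laplaceAK funEquiv funEquiv_apply)
open Summit.QuantumFields.YangMills.Theorems.Prop7SectET3Transport (periodsT3 bondEquiv bgOfCfg)
open Summit.QuantumFields.YangMills.Theorems.Prop7SectET3HilbertLetters (W₂ frobEquiv adBg adBgInv toL2 toL2B QL2 DL2 DstarL2 covLapSite toL2_symm_apply)
open Summit.QuantumFields.YangMills.Theorems.Prop7SectET3GaugeProjector (QDS NS RS mem_NS_iff QL2_DL2_eq_zero_of_mem_NS RS_apply_covLapSite_of_mem exists_mem_NS_RS_eq)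
open Summit.QuantumFields.YangMills.Theorems.Prop7SymAvgTwSym (QTwS)

variable {F : T3Family} {n K : ℕ} {h : n ≤ K} {c₀ cB a : ℝ} [Fact (0 < c₀)] [Fact (0 < cB)]
  {Δx : GaugeField (F.P K) 0 (Matrix.specialUnitaryGroup (Fin 2) ℂ) → (BondL2K ℂ 3 (periodsT3 F K) c₀ W₂ →ₗ[ℂ] BondL2K ℂ 3 (periodsT3 F K) c₀ W₂)}

/-! ## §1 `Δ_a` unfolded, `GΔ_a = 1`, and `Δ_a` on the residual pure gauges -/

/-- Unfolding `Δ_a x = Δx x + D(R_S(D*x)) + Q*(a·Q_k x)` (lit-balaban's `laplaceAK_apply` at the member's letters). [cite: Balaban1985BackgroundPropagators, (3.26) p.395] -/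
theorem laplaceA_apply (U₀ : GaugeField (F.P K) 0 (Matrix.specialUnitaryGroup (Fin 2) ℂ)) (x : BondL2K ℂ 3 (periodsT3 F K) c₀ W₂) :
    laplaceA F n K h c₀ cB a Δx U₀ x =
      Δx U₀ x + DL2 F n K c₀ U₀ (RS F n K h c₀ cB U₀ (DstarL2 F n K c₀ U₀ x)) +
        LinearMap.adjoint (Qk F n K h c₀ cB U₀) (((a : ℂ)) • Qk F n K h c₀ cB U₀ x) :=
  laplaceAK_apply _ _ _ _ _ _ _ x

/-- **`G Δ_a = 1` ON THE CLASS** (lit-balaban's `G1K_laplaceAK`). [cite: Balaban1985BackgroundPropagators, (3.27) p.395] -/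
theorem GT_laplaceA {U₀ : GaugeField (F.P K) 0 (Matrix.specialUnitaryGroup (Fin 2) ℂ)} (hp : PosOnto F n K h c₀ cB a Δx U₀) (x : BondL2K ℂ 3 (periodsT3 F K) c₀ W₂) :
    GT F n K h c₀ cB a Δx U₀ (laplaceA F n K h c₀ cB a Δx U₀ x) = x := by
  rw [GT_of_pos hp]
  exact G1K_laplaceAK hp.pos x

/-- **`Δ_a(Dλ) = D(Δ^η λ)` FOR A RESIDUAL PURE GAUGE `λ ∈ N_S(U₀)`**, when the Hessian letter kills `D N_S`: the `Δx` term vanishes (`hΔ`), the `Q*aQ` term vanishes ((3.115) on `N_S`), and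
`D R_S D*Dλ = D R_S Δ^ηλ = D Δ^ηλ` (`R_S` fixes `Δ^η N_S`). [cite: Balaban1985BackgroundPropagators, (3.124) p.420; Balaban1984PropagatorsII, (2.31) p.227] -/
theorem laplaceA_DL2_of_mem_NS {U₀ : GaugeField (F.P K) 0 (Matrix.specialUnitaryGroup (Fin 2) ℂ)}
    (hΔ : ∀ l ∈ NS F n K h c₀ cB U₀, Δx U₀ (DL2 F n K c₀ U₀ l) = 0) {l : SiteL2K ℂ 3 (periodsT3 F K) c₀ W₂} (hl : l ∈ NS F n K h c₀ cB U₀) :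
    laplaceA F n K h c₀ cB a Δx U₀ (DL2 F n K c₀ U₀ l) = DL2 F n K c₀ U₀ (covLapSite F n K c₀ U₀ l) := by
  have hQ : Qk F n K h c₀ cB U₀ (DL2 F n K c₀ U₀ l) = 0 := by
    rw [Qk, LinearMap.smul_apply, QL2_DL2_eq_zero_of_mem_NS U₀ hl, smul_zero]
  rw [laplaceA_apply, hΔ l hl, hQ, smul_zero, map_zero, zero_add, add_zero]
  -- `D*Dλ = Δ^ηλ` by `rfl`, then `R_S` fixes it
  show DL2 F n K c₀ U₀ (RS F n K h c₀ cB U₀ (covLapSite F n K c₀ U₀ l)) = _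
  rw [RS_apply_covLapSite_of_mem U₀ hl]

/-! ## §2 (3.124)₂ and `R_SD*GDR_S = R_S` -/

/-- ★ **`G(DR_Sf) = Dλ₀`** where `R_Sf = Δ^ηλ₀`, `λ₀ ∈ N_S` — the `B6Eq231` mechanism `apply_G_d_R` at the member. [cite: Balaban1984PropagatorsII, (2.31) p.227; Balaban1985BackgroundPropagators, (3.124) p.420] -/
theorem GT_DL2_RS {U₀ : GaugeField (F.P K) 0 (Matrix.specialUnitaryGroup (Fin 2) ℂ)} (hp : PosOnto F n K h c₀ cB a Δx U₀)
    (hΔ : ∀ l ∈ NS F n K h c₀ cB U₀, Δx U₀ (DL2 F n K c₀ U₀ l) = 0) (f : SiteL2K ℂ 3 (periodsT3 F K) c₀ W₂) :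
    ∃ l ∈ NS F n K h c₀ cB U₀, RS F n K h c₀ cB U₀ f = covLapSite F n K c₀ U₀ l ∧
      GT F n K h c₀ cB a Δx U₀ (DL2 F n K c₀ U₀ (RS F n K h c₀ cB U₀ f)) = DL2 F n K c₀ U₀ l := by
  obtain ⟨l, hl, hf⟩ := exists_mem_NS_RS_eq U₀ f
  refine ⟨l, hl, hf, ?_⟩
  rw [hf, ← laplaceA_DL2_of_mem_NS (a := a) hΔ hl, GT_laplaceA hp]

/-- ★★ **(3.124)₂ AT THE MEMBER: `Q_k G D R_S = 0`** (print: «hence QGDR = 0»; [B6] (2.34)₂) — the data relation `h124` of lit-balaban's `frakG_mem_constraint102`∕`Q_frakGLatticeK`, PROVED for the layer-0 letters on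
the class. [cite: Balaban1985BackgroundPropagators, (3.124) p.420; Balaban1984PropagatorsII, (2.34) p.228] -/
theorem Qk_GT_DL2_RS {U₀ : GaugeField (F.P K) 0 (Matrix.specialUnitaryGroup (Fin 2) ℂ)} (hp : PosOnto F n K h c₀ cB a Δx U₀)
    (hΔ : ∀ l ∈ NS F n K h c₀ cB U₀, Δx U₀ (DL2 F n K c₀ U₀ l) = 0) (s : SiteL2K ℂ 3 (periodsT3 F K) c₀ W₂) :
    Qk F n K h c₀ cB U₀ (GT F n K h c₀ cB a Δx U₀ (DL2 F n K c₀ U₀ (RS F n K h c₀ cB U₀ s))) = 0 := by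
  obtain ⟨l, hl, -, hG⟩ := GT_DL2_RS hp hΔ s
  rw [hG, Qk, LinearMap.smul_apply, QL2_DL2_eq_zero_of_mem_NS U₀ hl, smul_zero]

/-- ★★ **`R_S D* G D R_S = R_S` AT THE MEMBER** ([B6] (2.31); print: «RD*G₁DR = R», [Balaban1985Variational] p. 294) — the data relation `hRDR`, PROVED for the layer-0 letters on the class.
[cite: Balaban1984PropagatorsII, (2.31) p.227; Balaban1985Variational, p.294] -/
theorem RS_DstarL2_GT_DL2_RS {U₀ : GaugeField (F.P K) 0 (Matrix.specialUnitaryGroup (Fin 2) ℂ)} (hp : PosOnto F n K h c₀ cB a Δx U₀)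
    (hΔ : ∀ l ∈ NS F n K h c₀ cB U₀, Δx U₀ (DL2 F n K c₀ U₀ l) = 0) (s : SiteL2K ℂ 3 (periodsT3 F K) c₀ W₂) :
    RS F n K h c₀ cB U₀ (DstarL2 F n K c₀ U₀ (GT F n K h c₀ cB a Δx U₀ (DL2 F n K c₀ U₀ (RS F n K h c₀ cB U₀ s)))) = RS F n K h c₀ cB U₀ s := by
  obtain ⟨l, hl, hf, hG⟩ := GT_DL2_RS hp hΔ s
  rw [hG, hf]
  exact RS_apply_covLapSite_of_mem U₀ hl

/-! ## §3 «`Q𝔊 = 0`» and the EX binder `h102` -/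

/-- ★★ **«`Q𝔊 = 0`» FOR THE LAYER-0 `𝔊 = G𝔓*` ON THE CLASS, Hilbert level** — lit-balaban's `apply_Q_frakGLin` with `hK` (✓`Qk_GT_adjoint_KinvT`) and `h124` (✓`Qk_GT_DL2_RS`) DISCHARGED.
[cite: Balaban1985Variational, (102) p.293, p.294; Balaban1985BackgroundPropagators, (3.147) p.425] -/
theorem Qk_frakGT {U₀ : GaugeField (F.P K) 0 (Matrix.specialUnitaryGroup (Fin 2) ℂ)} (hp : PosOnto F n K h c₀ cB a Δx U₀)
    (hΔ : ∀ l ∈ NS F n K h c₀ cB U₀, Δx U₀ (DL2 F n K c₀ U₀ l) = 0) (x : BondL2K ℂ 3 (periodsT3 F K) c₀ W₂) :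
    Qk F n K h c₀ cB U₀ (frakGT F n K h c₀ cB a Δx U₀ x) = 0 :=
  apply_Q_frakGLin (Qk_GT_adjoint_KinvT hp) (Qk_GT_DL2_RS hp hΔ) x

/-- The EX knit's reading `b ↦ ι(𝒢f f)(bondEquiv b)` of the (115)-valued letter IS `toL2⁻¹ (𝔊 (funEquiv⁻¹ f))`. [cite: Balaban1985Variational, (111) p.294] -/
theorem iota_frakGfR_eq [Fact (0 < (F.L : ℝ))] [Fact (0 < ((F.L : ℝ)⁻¹) ^ (K - n))] (U₀ : GaugeField (F.P K) 0 (Matrix.specialUnitaryGroup (Fin 2) ℂ))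
    (f : NegSize (F.L : ℝ) (((F.L : ℝ)⁻¹) ^ (K - n)) (fun _ : Bond 3 (periodsT3 F K) => K - n) 3 (Matrix (Fin 2) (Fin 2) ℂ)) :
    (fun b : PBond (F.P K) 0 => JetSup.equiv _ _ _ (frakGfR F n K h c₀ cB a Δx U₀ f) (bondEquiv F K b)) =
      (toL2 F K c₀).symm (frakGT F n K h c₀ cB a Δx U₀ ((funEquiv frobEquiv (fun _ : Bond 3 (periodsT3 F K) => c₀)).symm (NegSup.equiv _ _ f))) := by
  funext b
  rw [jet_frakGfR_eq, funEquiv_apply, toL2_symm_apply]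

/-- ★★★ **THE EX BINDER `h102` VERBATIM FOR THE LAYER-0 LETTER ON THE CLASS: `QTwS U₀ (ι(𝒢f f)) = 0`** («Q𝔊 = 0» on the route carriers, for the averaging of record `QTwS` — v2.5 :170–172 with
`QTwS` for `QTw`), given the Hessian letter's gauge invariance on `N_S` (true for print's `Δ_π`). [cite: Balaban1985Variational, (102) p.293; Balaban1985BackgroundPropagators, (3.147) p.425] -/
theorem QTwS_iota_frakGfR [Fact (0 < (F.L : ℝ))] [Fact (0 < ((F.L : ℝ)⁻¹) ^ (K - n))] {U₀ : GaugeField (F.P K) 0 (Matrix.specialUnitaryGroup (Fin 2) ℂ)}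
    (hp : PosOnto F n K h c₀ cB a Δx U₀) (hΔ : ∀ l ∈ NS F n K h c₀ cB U₀, Δx U₀ (DL2 F n K c₀ U₀ l) = 0)
    (f : NegSize (F.L : ℝ) (((F.L : ℝ)⁻¹) ^ (K - n)) (fun _ : Bond 3 (periodsT3 F K) => K - n) 3 (Matrix (Fin 2) (Fin 2) ℂ)) :
    QTwS F n K h U₀ (fun b : PBond (F.P K) 0 => JetSup.equiv _ _ _ (frakGfR F n K h c₀ cB a Δx U₀ f) (bondEquiv F K b)) = 0 := by
  rw [iota_frakGfR_eq, QTwS_toL2_symm, QL2_eq_inv_smul_Qk, Qk_frakGT hp hΔ, smul_zero, map_zero]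

end Summit.QuantumFields.YangMills.Theorems.Prop7SectET3CurvedPropagators

end
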